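import Summits.Ventures.GridStability.Lyapunov.WSCC9LffNonUniform
import HarnessLib

/-!
# GridStability/Lyapunov/WSCC9LffNonUniformRoa — LFF-P1-NU: the certified synchronisation region of the LOSSLESS 9-bus
# variant WITH THE PRINTED NON-UNIFORM DAMPING (closed-form certificate, no λ), explicit level and non-emptiness

Cell `gridfusion` (LADDER-GRIDFUSION), LFF lane, lead rulings R-LFFNU / R-LFFNU-SF; seat gridfusion-lyap-1 (g4); namespace
`Summit.Ventures.GridStability.Lyapunov.WSCC9LffNU` (continued from `WSCC9LffNonUniformData.lean` — object, system, closed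
form, kernel facts — and `WSCC9LffNonUniform.lean` — the certificate member `cert` and the hypothesis-free bridge).
LABEL OF EVERY MENTION: «synthetic lossless VARIANT of the printed 9-bus (post-fault-B network, transfer conductances dropped,
block-C equilibrium, lossless redispatch) with the PRINTED NON-UNIFORM damping `D_i/M_i = 1/10, 1/5, 3/10` — a PIPELINE
sentence, not a 9-bus sentence»; tokens MV-2L synthetic + MV-RD + MV-SPD + MV-h12, NO MV-λ.
WHAT IS PROVED. `rank_one` (the six `s_kQ − C_kᵀC_k ⪰ 0` from the data file's Gram certificates); `hlam` (`λ₀ ≠ λ₁`: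
Pai's `2n − 1` form is observable); `well_subset_regionOfAttraction` — lit-6's central theorem on Pai's space (p495139)
[cite: VuTuritsyn2016, §IV set ℛ; Pai1981, §3.6.3 eq. (3.45)] for `cert`: every level
`c₀ < V(0) + (π − 2|δ*_k|)²/(2s_k) + K_k·vtGap(δ*_k)` gives a positively invariant `{𝒫, V ≤ c₀}` whose global solutions
exist and all tend to `0`; `level_roa` — EXPLICIT level: every `c₀ < 1657/10000 − 72029/20000 = −3.43575` (model-1's
certified tables `WSCC9.closedForm_level_pair`, p492027; the potential part of `V` is #12's, `c′ = 1`);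
`level_synchronisation` — HYPOTHESIS-FREE on model-1's typed `data.toModel` (lossless post-B network, damping `D_SP`,
injections `P′`): every solution whose initial machine-reference state lies in `{𝒫, V ≤ c₀}` keeps it and has ALL THREE
speed deviations `ω_i → 0` and `δ_m − δ_0 → θ*_m − θ*_0`; `V_zero_lt_level` / `zero_mem_polytope` / `level_nonempty` —
the admissible interval `[V(0), −3.43575)` is non-empty (`V(0) ≈ −3.6014`; lyap-1 `LffLevelNonempty` p496343) and every
such set contains the equilibrium.
THREE COLUMNS. CERTIFIED: these sentences for MODEL M′ as LABEL. VALIDATED: nothing (no SDP, no solver anywhere).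
No sentence of this file says that the WSCC 9-bus system or any grid is stable. No definition; no named fact;
standard axioms.
-/

noncomputable section

open Set Filter Topology Real Matrix Finset
open Literature.Computation.Certificates
open Literature.MathematicalPhysics.PowerSystems
open Literature.MathematicalPhysics.PowerSystems.LyapunovFunctionFamily
open Literature.MathematicalPhysics.PowerSystems.ClassicalModel.LosslessSystem (vtGap)
open Summit.Ventures.GridStability.Models
open Summit.Ventures.GridStability.Lyapunov.RelativeLff

namespace Summit.Ventures.GridStability.Lyapunov.WSCC9LffNU

/-! ### THE CERTIFIED REGION on Pai's space (non-uniform damping) -/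

/-- Rank-one facts `s_k·Q − C_kᵀC_k ⪰ 0` (integer Gram certificates `gramS`, reindexed by `e5`). -/
theorem rank_one (k : RecastData.LffPair 2) :
    ((sq k : ℝ) • cert.Q - Matrix.vecMulVec (sys.C k) (sys.C k)).PosSemidef := by
  have h := (gramS k).posSemidef_of_smul (R := ℝ) (cS_pos (pairIdx k)) (gramS_smul k)
  have e : ((sq k : ℝ) • cert.Q - Matrix.vecMulVec (sys.C k) (sys.C k))
      = ((sq k • Q5 - Matrix.vecMulVec (c5 k) (c5 k)).map (Rat.cast : ℚ → ℝ)).submatrix e5 e5 := by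
    ext i j
    rw [sys_C]
    simp [cert, QR, Qq, c5, Matrix.vecMulVec]
  rw [e]
  exact (Matrix.posSemidef_submatrix_equiv e5).2 h

/-- Equilibrium line angles inside the polytope. -/
theorem abs_δs_lt (k : RecastData.LffPair 2) : |RecastData.lffδso data.angleOf k| < π / 2 :=
  abs_δs_lt_of_acute data data_acute.1 data_acute.2 k

/-- Non-uniform damping ratios as reals: `λ₀ ≠ λ₁`. -/
theorem hlam : ∃ i j : Fin 3, (fun i => data.toModel.toLitNode.D i / data.toModel.toLitNode.M i) i
    ≠ (fun i => data.toModel.toLitNode.D i / data.toModel.toLitNode.M i) j := by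
  refine ⟨0, 1, ?_⟩
  simp only [ClassicalSwing.toLitNode_M]
  show ¬ ((data.D 0 : ℚ) : ℝ) / ((data.M 0 : ℚ) : ℝ) = ((data.D 1 : ℚ) : ℝ) / ((data.M 1 : ℚ) : ℝ)
  exact_mod_cast data_hlam

/-- **LFF-P1-NU: the certified synchronisation region of «WSCC9-postB-L-SPdamp» on Pai's machine-reference
space** ([cite: VuTuritsyn2016, §IV set ℛ], lit-6's observability form p495139): for every level
`c₀ < V(0) + (π − 2|δ*_k|)²/(2s_k) + K_k·vtGap(δ*_k)` on all six channels and every `y ∈ 𝒫` with `V y ≤ c₀`, a global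
solution of `sys` exists and EVERY global solution keeps `{𝒫, V ≤ c₀}` and tends to `0`. MODELLED: synthetic lossless
variant with the PRINTED non-uniform damping. -/
theorem well_subset_regionOfAttraction {c₀ : ℝ}
    (hc₀ : ∀ k, c₀ < cert.V 0 + (π - 2 * |RecastData.lffδso data.angleOf k|) ^ 2 / (2 * (sq k : ℝ))
      + KR k * vtGap (RecastData.lffδso data.angleOf k))
    {y : Fin 3 ⊕ Fin 2 → ℝ} (hy : y ∈ sys.polytope) (hyc : cert.V y ≤ c₀) :
    (∃ X : ℝ → Fin 3 ⊕ Fin 2 → ℝ, X 0 = y ∧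
        ∀ τ : ℝ, ∀ t ∈ Icc 0 τ, HasDerivWithinAt X (sys.field (X t)) (Icc 0 τ) t) ∧
      ∀ X : ℝ → Fin 3 ⊕ Fin 2 → ℝ, X 0 = y →
        (∀ τ : ℝ, ∀ t ∈ Icc 0 τ, HasDerivWithinAt X (sys.field (X t)) (Icc 0 τ) t) →
        (∀ t, 0 ≤ t → X t ∈ sys.polytope ∧ cert.V (X t) ≤ c₀) ∧ Tendsto X atTop (𝓝 0) :=
  cert.machineReference_well_subset_regionOfAttraction_of_gapQ (fun v hv => WSCC9Lff.kerE v hv)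
    (fun ω hω => InternalNode.refT_ker ω hω) hlam abs_δs_lt (fun k => by exact_mod_cast sq_pos k) rank_one hc₀ hy hyc

/-! ### Explicit level, synchronisation of the typed model, non-emptiness -/

/-- `K` is model-1's half weight `w = C/2` (cast bookkeeping). -/
theorem KR_eq (k : RecastData.LffPair 2) : KR k = WSCC9.postB_relL.lffWo k := by
  unfold KR Kq
  show ((data.Cc k.1.1 k.1.2 / 2 : ℚ) : ℝ) = (WSCC9.postB_relL.Cc k.1.1 k.1.2 : ℝ) / 2
  push_cast; rfl

/-- The equilibrium angles are those of `postB_relL` (same circle points; bookkeeping). -/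
theorem angleOf_eq : data.angleOf = WSCC9.postB_relL.angleOf := rfl

/-- **From one rational number to the symbolic level hypothesis**: every `c₀ < 1657/10000 − 72029/20000 = −3.43575`
is admissible (model-1's certified tables `WSCC9.closedForm_level_pair`, `c′ = 1`; the rank-one gap term is dropped). -/
theorem hc₀_of_level {c₀ : ℝ} (h : c₀ < (1657 : ℝ) / 10000 - 72029 / 20000) (k : RecastData.LffPair 2) :
    c₀ < cert.V 0 + (π - 2 * |RecastData.lffδso data.angleOf k|) ^ 2 / (2 * (sq k : ℝ))
      + KR k * vtGap (RecastData.lffδso data.angleOf k) := by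
  have h1 := WSCC9.closedForm_level_pair 1 (by norm_num) k
  have hgap : 0 ≤ (π - 2 * |RecastData.lffδso data.angleOf k|) ^ 2 / (2 * (sq k : ℝ)) := by
    have := sq_pos k; positivity
  rw [Certificate.V_zero]
  show c₀ < -(∑ k', KR k' * (Real.cos (RecastData.lffδso data.angleOf k')
      + RecastData.lffδso data.angleOf k' * Real.sin (RecastData.lffδso data.angleOf k'))) + _ + _
  simp only [KR_eq, angleOf_eq] at hgap ⊢
  simp only [one_mul] at h1
  linarith

/-- **Explicit-level region**: every `c₀ < −3.43575` gives a positively invariant set `{𝒫, V ≤ c₀}` of `sys` whose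
global solutions all tend to `0`. [cite: VuTuritsyn2016, §IV set ℛ] -/
theorem level_roa {c₀ : ℝ} (h : c₀ < (1657 : ℝ) / 10000 - 72029 / 20000)
    {y : Fin 3 ⊕ Fin 2 → ℝ} (hy : y ∈ sys.polytope) (hyc : cert.V y ≤ c₀) :
    (∃ X : ℝ → Fin 3 ⊕ Fin 2 → ℝ, X 0 = y ∧
        ∀ τ : ℝ, ∀ t ∈ Icc 0 τ, HasDerivWithinAt X (sys.field (X t)) (Icc 0 τ) t) ∧
      ∀ X : ℝ → Fin 3 ⊕ Fin 2 → ℝ, X 0 = y →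
        (∀ τ : ℝ, ∀ t ∈ Icc 0 τ, HasDerivWithinAt X (sys.field (X t)) (Icc 0 τ) t) →
        (∀ t, 0 ≤ t → X t ∈ sys.polytope ∧ cert.V (X t) ≤ c₀) ∧ Tendsto X atTop (𝓝 0) :=
  well_subset_regionOfAttraction (fun k => hc₀_of_level h k) hy hyc

/-- **Explicit-level synchronisation of the typed model (hypothesis-free).** For EVERY solution `c` of
`data.toModel` (lossless post-B 9-bus, PRINTED non-uniform damping `D_i/M_i = 1/10, 1/5, 3/10`, injections `P′`)
on `univ` whose initial machine-reference state `((ω_i)_i | ((δ_m − δ_0) − (θ*_m − θ*_0))_m)` lies in `𝒫` with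
`V ≤ c₀ < −3.43575`: the state keeps `{𝒫, V ≤ c₀}` and tends to `0` — ALL THREE speed deviations `ω_i → 0` and
`δ_m − δ_0 → θ*_m − θ*_0`. MODELLED as LABEL; no sentence here says a grid is stable.
[cite: VuTuritsyn2016, §IV set ℛ; Pai1981, §3.6.3 eq. (3.45)] -/
theorem level_synchronisation {c₀ : ℝ} (h : c₀ < (1657 : ℝ) / 10000 - 72029 / 20000)
    {c : ℝ → ClassicalSwing.State 3} (hc : data.toModel.IsSolutionOn c univ)
    (hy : data.lurieState data.angleOf (c 0) ∈ sys.polytope)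
    (hyc : cert.V (data.lurieState data.angleOf (c 0)) ≤ c₀) :
    (∀ t, 0 ≤ t → data.lurieState data.angleOf (c t) ∈ sys.polytope ∧
        cert.V (data.lurieState data.angleOf (c t)) ≤ c₀) ∧
      Tendsto (fun t => data.lurieState data.angleOf (c t)) atTop (𝓝 0) := by
  obtain ⟨-, hall⟩ := level_roa h hy hyc
  exact hall (fun t => data.lurieState data.angleOf (c t)) rfl fun τ t _ => hasDerivWithinAt_state hc t

/-- **Non-emptiness**: `V(0) < −3.43575` (`V(0) ≈ −3.6014`; ONE rational comparison, lyap-1 p496343 pattern). -/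
theorem V_zero_lt_level : cert.V 0 < (1657 : ℝ) / 10000 - 72029 / 20000 := by
  have hw : ∀ k, 0 ≤ woq WSCC9.postB_relL k := fun k =>
    div_nonneg (WSCC9.postB_relL_Cc_pos k.1.1 k.1.2 k.2).le (by norm_num)
  have h := neg_sum_lt_of_level_pair WSCC9.postB_relL WSCC9.postB_relL_eqData WSCC9.postB_relL_c_pos
    WSCC9.angleLo_le WSCC9.angleOf_le_angleHi (woq WSCC9.postB_relL) hw one_pos WSCC9Lff.neg_sum_eqTermLo_lt_pair
  rw [Certificate.V_zero]
  show -(∑ k', KR k' * (Real.cos (RecastData.lffδso data.angleOf k')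
      + RecastData.lffδso data.angleOf k' * Real.sin (RecastData.lffδso data.angleOf k'))) < _
  simp only [KR_eq, angleOf_eq]
  simp only [one_mul, woq_cast] at h
  push_cast at h
  linarith

/-- The synchronous equilibrium lies in the polytope of `sys`. -/
theorem zero_mem_polytope : (0 : Fin 3 ⊕ Fin 2 → ℝ) ∈ sys.polytope := zero_mem_polytope_of_abs_lt _ abs_δs_lt

/-- **Rider**: an admissible level whose certified set contains the equilibrium exists (witness `c₀ = V(0)`). -/
theorem level_nonempty : ∃ c₀ : ℝ, c₀ < (1657 : ℝ) / 10000 - 72029 / 20000 ∧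
    (0 : Fin 3 ⊕ Fin 2 → ℝ) ∈ sys.polytope ∧ cert.V 0 ≤ c₀ :=
  ⟨_, V_zero_lt_level, zero_mem_polytope, le_rfl⟩

end Summit.Ventures.GridStability.Lyapunov.WSCC9LffNU

end
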